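import Summits.SmoothPoincare4.SmoothPoincare4.Theorems.SymplecticOrigamiOrigamiFoldExistenceShadowPleatsDefs
import Mathlib.Analysis.InnerProductSpace.Calculus
import Mathlib.Analysis.Calculus.Deriv.Comp
import Mathlib.Analysis.Calculus.Deriv.Pow
import Mathlib.Analysis.Calculus.Deriv.Mul
import Mathlib.Analysis.Calculus.Deriv.Add

/-!
# Line `shadow-pleats` for crux `OrigamiFoldExistence`: the MODEL PLEAT CHART
(item stmt-SmoothPoincare4-7844, route route-SmoothPoincare4-SymplecticOrigami)

Non-vacuity certificate for the `k ≥ 1` clauses of the line's vocabulary `IsPleatedPosition`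
(Defs file `…ShadowPleatsDefs.lean`, p96059), settling the typing question "is `IsFoldPointAt`
satisfiable at ALL points of BOTH fold spheres of ONE pleat chart, simultaneously with the
immersivity clause, for the shadow of an EMBEDDED hypersurface?" by an explicit polynomial witness
(registered sub-goal `exists_modelPleatChart`; everything here is proved, no named facts).

THE RADIAL PLEAT.  `G u = q(‖u‖²) • u` with `q s = 60 - 25 s + 3 s²`, so that the shadow radius
`r(t) = t q(t²) = 60 t - 25 t³ + 3 t⁵` has `r'(t) = 15 (t² - 1)(t² - 4)`: a `Z`-profile, increasing
on `(0, 1)`, decreasing on `(1, 2)` (`r(1) = 38 > r(2) = 16 > 0`), increasing on `(2, ∞)`, with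
non-degenerate turning points.  Its LIFT `L u = (G u, ‖u‖²) ∈ ℂ² × ℝ` is a smooth injective
immersion `ℝ⁴ → ℝ⁵` (a hypersurface of revolution whose radius is a function of the height) with
`proj5 ∘ L = G`, and:
* `dG(u) w = q(s) w + 2 q'(s) ⟪u, w⟫ u` (`s = ‖u‖²`), `⟪u, dG(u) w⟫ = 15 (s - 1)(s - 4) ⟪u, w⟫`,
  `q > 0`: the shadow is immersive exactly off the round spheres `‖u‖ = 1, 2`, i.e. off
  `pleatSpheres` (`ModelPleat.injective_dG`);
* on `pleatSpheres` the kernel is `ℝ u` (`dG(u) u = 15 (s - 1)(s - 4) u = 0`), `range dG(u) ⊆ u^⊥`,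
  and the intrinsic second derivative is `D²G(u)[u, u] = (6 s q'(s) + 24 s²) u`, `= -90 u` at
  `s = 1` and `= 360 u` at `s = 4`, NOT in `u^⊥`: a Whitney fold at every point of both spheres
  (`ModelPleat.isFoldPointAt_G`).
So the pleat-chart, immersivity and fold clauses of `IsPleatedPosition` are jointly satisfiable by
one chart of an embedded hypersurface (`exists_modelPleatChart`).  Closing the model up into a
`1`-pleat position of the round `S⁴` (graft it onto the polar cap above the plane `h = 1 - δ`) is
routine and deliberately not done here; nor is anything about pleat NUMBERS.

References: H. Whitney, *On singularities of mappings of Euclidean spaces I*, Ann. of Math. 62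
(1955), §4 (fold points); Y. Eliashberg, N. Mishachev, *Wrinkled embeddings*, Contemp. Math. 498
(2009), arXiv:1108.1265, §2.10 (double folds).  Standard calculus; tagged folklore.
-/

noncomputable section

-- the prescribed namespace `Summit.<P>.<Sub>.…` duplicates `SmoothPoincare4` (P = Sub)
set_option linter.dupNamespace false

open scoped Manifold ContDiff Topology RealInnerProductSpace
open Set Function

namespace Summit.SmoothPoincare4.SmoothPoincare4.Theorems.OrigamiFoldExistence.ShadowPleats

namespace ModelPleat

/-- The profile factor `q s = 60 - 25 s + 3 s²` (shadow radius `r(t) = t q(t²)`). [folklore] -/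
def q (s : ℝ) : ℝ := 60 - 25 * s + 3 * s ^ 2

/-- Its derivative `q' s = -25 + 6 s`. [folklore] -/
def dq (s : ℝ) : ℝ := -25 + 6 * s

/-- `q' = dq`. [folklore] -/
theorem hasDerivAt_q (s : ℝ) : HasDerivAt q (dq s) s := by
  have h := (((hasDerivAt_id' s).const_mul (25 : ℝ)).const_sub (60 : ℝ)).fun_add
    ((hasDerivAt_pow 2 s).const_mul (3 : ℝ))
  have he : (-(25 * 1) + 3 * (↑(2 : ℕ) * s ^ (2 - 1)) : ℝ) = dq s := by
    norm_num [dq]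
    ring
  rw [he] at h
  exact h

/-- `q'' = 6`. [folklore] -/
theorem hasDerivAt_dq (s : ℝ) : HasDerivAt dq 6 s := by
  have h := ((hasDerivAt_id' s).const_mul (6 : ℝ)).const_add (-25 : ℝ)
  rw [mul_one] at h
  exact h

/-- `q > 0` everywhere (`3 s² - 25 s + 60` has negative discriminant). [folklore] -/
theorem q_pos (s : ℝ) : 0 < q s := by
  unfold q
  nlinarith [sq_nonneg (s - 25 / 6)]

/-- The radial factor `q s + 2 s q' s = 15 (s - 1)(s - 4)` (`= r'(t)` at `s = t²`). [folklore] -/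
theorem q_add_two_mul (s : ℝ) : q s + 2 * s * dq s = 15 * (s - 1) * (s - 4) := by
  unfold q dq
  ring

/-- `q` is smooth. [folklore] -/
theorem contDiff_q : ContDiff ℝ ∞ q := by
  unfold q
  fun_prop

/-- `‖·‖²` has derivative `2 ⟪u, ·⟫`. [folklore] -/
theorem hasFDerivAt_normSq (u : EuclideanSpace ℝ (Fin 4)) :
    HasFDerivAt (fun w : EuclideanSpace ℝ (Fin 4) => ‖w‖ ^ 2) ((2 : ℝ) • innerSL ℝ u) u := by
  refine (hasStrictFDerivAt_norm_sq u).hasFDerivAt.congr_fderiv ?_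
  ext w
  simp [two_smul]

/-- The MODEL PLEAT SHADOW `G u = q(‖u‖²) • u`. [folklore] -/
def G (u : EuclideanSpace ℝ (Fin 4)) : EuclideanSpace ℝ (Fin 4) := q (‖u‖ ^ 2) • u

/-- Its derivative `dG(u) = q(s) • id + (q'(s) · 2⟪u, ·⟫) ⊗ u`, `s = ‖u‖²`. [folklore] -/
def dG (u : EuclideanSpace ℝ (Fin 4)) : EuclideanSpace ℝ (Fin 4) →L[ℝ] EuclideanSpace ℝ (Fin 4) :=
  q (‖u‖ ^ 2) • ContinuousLinearMap.id ℝ (EuclideanSpace ℝ (Fin 4)) +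
    (dq (‖u‖ ^ 2) • ((2 : ℝ) • innerSL ℝ u)).smulRight u

/-- `dG` is the derivative of `G`. [folklore] -/
theorem hasFDerivAt_G (u : EuclideanSpace ℝ (Fin 4)) : HasFDerivAt G (dG u) u := by
  have hq := (hasDerivAt_q (‖u‖ ^ 2)).comp_hasFDerivAt u (hasFDerivAt_normSq u)
  exact hq.smul (hasFDerivAt_id u)

/-- `fderiv G = dG`. [folklore] -/
theorem fderiv_G (u : EuclideanSpace ℝ (Fin 4)) : fderiv ℝ G u = dG u := (hasFDerivAt_G u).fderiv

/-- `dG(u) w = q(s) w + (2 q'(s) ⟪u, w⟫) u`. [folklore] -/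
theorem dG_apply (u w : EuclideanSpace ℝ (Fin 4)) :
    dG u w = q (‖u‖ ^ 2) • w + (2 * dq (‖u‖ ^ 2) * ⟪u, w⟫) • u := by
  simp only [dG, add_apply, smul_apply, ContinuousLinearMap.id_apply,
    ContinuousLinearMap.smulRight_apply, innerSL_apply_apply, smul_eq_mul]
  congr 1
  ring_nf

/-- `⟪u, dG(u) w⟫ = 15 (s - 1)(s - 4) ⟪u, w⟫`. [folklore] -/
theorem inner_dG_apply (u w : EuclideanSpace ℝ (Fin 4)) :
    ⟪u, dG u w⟫ = 15 * (‖u‖ ^ 2 - 1) * (‖u‖ ^ 2 - 4) * ⟪u, w⟫ := by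
  rw [dG_apply, inner_add_right, inner_smul_right, inner_smul_right, real_inner_self_eq_norm_sq,
    ← q_add_two_mul]
  ring

/-- `dG(u) u = 15 (s - 1)(s - 4) u`. [folklore] -/
theorem dG_apply_self (u : EuclideanSpace ℝ (Fin 4)) :
    dG u u = (15 * (‖u‖ ^ 2 - 1) * (‖u‖ ^ 2 - 4)) • u := by
  rw [dG_apply, real_inner_self_eq_norm_sq, ← add_smul, ← q_add_two_mul]
  congr 1
  ring

/-- If `⟪u, w⟫ = 0` and `dG(u) w = 0` then `w = 0` (`q > 0`). [folklore] -/
theorem eq_zero_of_dG_apply_eq_zero {u w : EuclideanSpace ℝ (Fin 4)} (hinner : ⟪u, w⟫ = 0)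
    (h : dG u w = 0) : w = 0 := by
  rw [dG_apply, hinner, mul_zero, zero_smul, add_zero] at h
  exact (smul_eq_zero.mp h).resolve_left (q_pos _).ne'

/-- `u ∈ pleatSpheres ↔ (s - 1)(s - 4) = 0`, `s = ‖u‖²`. [folklore] -/
theorem mem_pleatSpheres_iff (u : EuclideanSpace ℝ (Fin 4)) :
    u ∈ pleatSpheres ↔ (‖u‖ ^ 2 - 1) * (‖u‖ ^ 2 - 4) = 0 := by
  have h0 := norm_nonneg u
  simp only [pleatSpheres, Set.mem_union, mem_sphere_zero_iff_norm, mul_eq_zero]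
  constructor
  · rintro (h | h)
    · left
      rw [h]
      norm_num
    · right
      rw [h]
      norm_num
  · rintro (h | h)
    · left
      nlinarith
    · right
      nlinarith

/-- Off the fold spheres the shadow is immersive: `dG(u)` is injective when `‖u‖ ∉ {1, 2}`.
[folklore] -/
theorem injective_dG {u : EuclideanSpace ℝ (Fin 4)} (hu : u ∉ pleatSpheres) :
    Function.Injective (dG u) := by
  rw [mem_pleatSpheres_iff] at hu
  intro w₁ w₂ h
  have h0 : dG u (w₁ - w₂) = 0 := by rw [map_sub, h, sub_self]
  have hin : ⟪u, w₁ - w₂⟫ = 0 := by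
    have h1 := inner_dG_apply u (w₁ - w₂)
    rw [h0, inner_zero_right] at h1
    have h15 : (15 * (‖u‖ ^ 2 - 1) * (‖u‖ ^ 2 - 4) : ℝ) ≠ 0 := by
      rw [mul_assoc]
      exact mul_ne_zero (by norm_num) hu
    exact (mul_eq_zero.mp h1.symm).resolve_left h15
  exact sub_eq_zero.mp (eq_zero_of_dG_apply_eq_zero hin h0)

/-! ### The second derivative on the fold spheres -/

/-- The derivative of `w ↦ dG(w) v` at `u`. [folklore] -/
def d2G (u v : EuclideanSpace ℝ (Fin 4)) :
    EuclideanSpace ℝ (Fin 4) →L[ℝ] EuclideanSpace ℝ (Fin 4) :=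
  (dq (‖u‖ ^ 2) • ((2 : ℝ) • innerSL ℝ u)).smulRight v +
    ((2 * dq (‖u‖ ^ 2) * ⟪v, u⟫) • ContinuousLinearMap.id ℝ (EuclideanSpace ℝ (Fin 4)) +
      ((2 * dq (‖u‖ ^ 2)) • innerSL ℝ v +
        ⟪v, u⟫ • ((2 : ℝ) • ((6 : ℝ) • ((2 : ℝ) • innerSL ℝ u)))).smulRight u)

/-- `w ↦ dG(w) v = q(‖w‖²) v + (2 q'(‖w‖²) ⟪v, w⟫) w` has derivative `d2G u v` at `u`. [folklore] -/
theorem hasFDerivAt_dG_apply (u v : EuclideanSpace ℝ (Fin 4)) :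
    HasFDerivAt (fun w => dG w v) (d2G u v) u := by
  have hfun : (fun w => dG w v) = fun w : EuclideanSpace ℝ (Fin 4) =>
      q (‖w‖ ^ 2) • v + (2 * dq (‖w‖ ^ 2) * ⟪v, w⟫) • w := by
    funext w
    rw [dG_apply, real_inner_comm]
  rw [hfun]
  have hq := (hasDerivAt_q (‖u‖ ^ 2)).comp_hasFDerivAt u (hasFDerivAt_normSq u)
  have hdq := (hasDerivAt_dq (‖u‖ ^ 2)).comp_hasFDerivAt u (hasFDerivAt_normSq u)
  have h2dq : HasFDerivAt (fun w : EuclideanSpace ℝ (Fin 4) => 2 * dq (‖w‖ ^ 2))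
      ((2 : ℝ) • ((6 : ℝ) • ((2 : ℝ) • innerSL ℝ u))) u := hdq.const_mul 2
  have hinner : HasFDerivAt (fun w : EuclideanSpace ℝ (Fin 4) => ⟪v, w⟫) (innerSL ℝ v) u :=
    (innerSL ℝ v).hasFDerivAt
  have hc := h2dq.mul hinner
  exact (hq.smul_const v).add (hc.smul (hasFDerivAt_id u))

/-- On the ray: `D²G(u)[u, u] = (6 s q'(s) + 24 s²) u`, `s = ‖u‖²`. [folklore] -/
theorem d2G_apply_self (u : EuclideanSpace ℝ (Fin 4)) :
    d2G u u u = (6 * ‖u‖ ^ 2 * dq (‖u‖ ^ 2) + 24 * (‖u‖ ^ 2) ^ 2) • u := by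
  simp only [d2G, add_apply, smul_apply, ContinuousLinearMap.id_apply,
    ContinuousLinearMap.smulRight_apply, innerSL_apply_apply, smul_eq_mul,
    real_inner_self_eq_norm_sq, ← add_smul]
  congr 1
  ring

/-- The second-derivative term of `IsFoldPointAt` for `G` along `v = u`. [folklore] -/
theorem fderiv_fderiv_G_self (u : EuclideanSpace ℝ (Fin 4)) :
    fderiv ℝ (fun w => fderiv ℝ G w u) u u =
      (6 * ‖u‖ ^ 2 * dq (‖u‖ ^ 2) + 24 * (‖u‖ ^ 2) ^ 2) • u := by
  have hfun : (fun w => fderiv ℝ G w u) = fun w => dG w u := by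
    funext w
    rw [fderiv_G]
  rw [hfun, (hasFDerivAt_dG_apply u u).fderiv, d2G_apply_self]

/-- **Whitney fold at every point of both fold spheres.** For `u ∈ pleatSpheres` the radial pleat
`G` has kernel vector `u` and `D²G(u)[u, u] ∉ range dG(u) = u^⊥`. [folklore] -/
theorem isFoldPointAt_G {u : EuclideanSpace ℝ (Fin 4)} (hu : u ∈ pleatSpheres) :
    IsFoldPointAt G u := by
  have hs : (‖u‖ ^ 2 - 1) * (‖u‖ ^ 2 - 4) = 0 := (mem_pleatSpheres_iff u).mp hu
  have hu0 : u ≠ 0 := by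
    rintro rfl
    norm_num at hs
  -- the scalar `c = 6 s q'(s) + 24 s²` times `s` is non-zero on both spheres (`-90`, `1440`)
  have hcs : (6 * ‖u‖ ^ 2 * dq (‖u‖ ^ 2) + 24 * (‖u‖ ^ 2) ^ 2) * ‖u‖ ^ 2 ≠ 0 := by
    rcases mul_eq_zero.mp hs with h | h
    · have h1 : ‖u‖ ^ 2 = 1 := by linarith
      rw [h1]; norm_num [dq]
    · have h4 : ‖u‖ ^ 2 = 4 := by linarith
      rw [h4]; norm_num [dq]
  refine ⟨u, hu0, ?_, ?_⟩
  · rw [fderiv_G, dG_apply_self, mul_assoc (15 : ℝ), hs, mul_zero, zero_smul]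
  · rw [fderiv_fderiv_G_self, fderiv_G]
    rintro ⟨w, hw⟩
    have h1 := inner_dG_apply u w
    have hw' : dG u w = (6 * ‖u‖ ^ 2 * dq (‖u‖ ^ 2) + 24 * (‖u‖ ^ 2) ^ 2) • u := hw
    rw [hw', inner_smul_right, real_inner_self_eq_norm_sq, mul_assoc (15 : ℝ), hs] at h1
    simp only [mul_zero, zero_mul] at h1
    exact hcs h1

/-! ### The lift to `ℝ⁵`: an injective immersion with shadow `G` -/

/-- The inclusion `ℝ⁴ = ℂ² ↪ ℂ² × ℝ = ℝ⁵`, `x ↦ (x, 0)`, as a continuous linear map. [folklore] -/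
def embed4 : EuclideanSpace ℝ (Fin 4) →L[ℝ] EuclideanSpace ℝ (Fin 5) :=
  LinearMap.toContinuousLinearMap
    { toFun := fun x => WithLp.toLp 2 ![x 0, x 1, x 2, x 3, 0]
      map_add' := fun x y => by
        ext i
        fin_cases i <;> simp
      map_smul' := fun c x => by
        ext i
        fin_cases i <;> simp }

/-- The vertical unit vector `∂_h = e₄` of `ℝ⁵`. [folklore] -/
def e4 : EuclideanSpace ℝ (Fin 5) := EuclideanSpace.single (4 : Fin 5) (1 : ℝ)

/-- The shadow forgets the vertical component: `proj5 (embed4 x + c • e₄) = x`. [folklore] -/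
theorem proj5_embed4_add_smul (x : EuclideanSpace ℝ (Fin 4)) (c : ℝ) :
    proj5 (embed4 x + c • e4) = x := by
  ext i
  fin_cases i <;> simp [proj5, embed4, e4]

/-- The height of `embed4 x + c • e₄` is `c`. [folklore] -/
theorem embed4_add_smul_apply_four (x : EuclideanSpace ℝ (Fin 4)) (c : ℝ) :
    (embed4 x + c • e4) 4 = c := by
  simp [embed4, e4]

/-- The LIFT `L u = (G u, ‖u‖²)`: the radial pleat as a hypersurface of `ℝ⁵ = ℂ² × ℝ` (radius a
function of the height). [folklore] -/
def L (u : EuclideanSpace ℝ (Fin 4)) : EuclideanSpace ℝ (Fin 5) := embed4 (G u) + (‖u‖ ^ 2) • e4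

/-- The shadow of the lift is the radial pleat: `proj5 ∘ L = G`. [folklore] -/
theorem proj5_comp_L : proj5 ∘ L = G := by
  funext u
  exact proj5_embed4_add_smul (G u) (‖u‖ ^ 2)

/-- The height of the lift is `‖u‖²`. [folklore] -/
theorem L_apply_four (u : EuclideanSpace ℝ (Fin 4)) : L u 4 = ‖u‖ ^ 2 :=
  embed4_add_smul_apply_four (G u) (‖u‖ ^ 2)

/-- `G` is smooth. [folklore] -/
theorem contDiff_G : ContDiff ℝ ∞ G :=
  (contDiff_q.comp (contDiff_norm_sq ℝ)).smul contDiff_id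

/-- The lift is smooth. [folklore] -/
theorem contDiff_L : ContDiff ℝ ∞ L :=
  (embed4.contDiff.comp contDiff_G).add ((contDiff_norm_sq ℝ).smul contDiff_const)

/-- The lift is injective (the height recovers `‖u‖²`, then `G u = q(‖u‖²) u` recovers `u`).
[folklore] -/
theorem injective_L : Function.Injective L := by
  intro u u' h
  have hh : ‖u‖ ^ 2 = ‖u'‖ ^ 2 := by rw [← L_apply_four u, ← L_apply_four u', h]
  have hG : G u = G u' := by
    have := congrArg proj5 h
    rwa [show proj5 (L u) = G u from congrFun proj5_comp_L u,
      show proj5 (L u') = G u' from congrFun proj5_comp_L u'] at this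
  unfold G at hG
  rw [hh] at hG
  exact smul_right_injective _ (q_pos _).ne' hG

/-- The derivative of the lift. [folklore] -/
def dL (u : EuclideanSpace ℝ (Fin 4)) : EuclideanSpace ℝ (Fin 4) →L[ℝ] EuclideanSpace ℝ (Fin 5) :=
  embed4.comp (dG u) + ((2 : ℝ) • innerSL ℝ u).smulRight e4

/-- `dL` is the derivative of `L`. [folklore] -/
theorem hasFDerivAt_L (u : EuclideanSpace ℝ (Fin 4)) : HasFDerivAt L (dL u) u :=
  (embed4.hasFDerivAt.comp u (hasFDerivAt_G u)).add ((hasFDerivAt_normSq u).smul_const e4)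

/-- **The lift is an immersion**: `dL(u)` is injective at every `u` (a vector killed by `dL(u)`
is horizontal, `⟪u, w⟫ = 0`, and killed by `dG(u)`, hence zero since `q > 0`). [folklore] -/
theorem injective_fderiv_L (u : EuclideanSpace ℝ (Fin 4)) : Function.Injective (fderiv ℝ L u) := by
  rw [(hasFDerivAt_L u).fderiv]
  intro w₁ w₂ h
  have h0 : dL u (w₁ - w₂) = 0 := by rw [map_sub, h, sub_self]
  have hdL : dL u (w₁ - w₂) = embed4 (dG u (w₁ - w₂)) + (2 * ⟪u, w₁ - w₂⟫) • e4 := by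
    simp [dL, ContinuousLinearMap.smulRight_apply, innerSL_apply_apply]
  rw [hdL] at h0
  have hin : ⟪u, w₁ - w₂⟫ = 0 := by
    have := embed4_add_smul_apply_four (dG u (w₁ - w₂)) (2 * ⟪u, w₁ - w₂⟫)
    rw [h0] at this
    simpa using this.symm
  have hG : dG u (w₁ - w₂) = 0 := by
    have := proj5_embed4_add_smul (dG u (w₁ - w₂)) (2 * ⟪u, w₁ - w₂⟫)
    rw [h0] at this
    rw [← this]
    simpa using (proj5L.map_zero)
  exact sub_eq_zero.mp (eq_zero_of_dG_apply_eq_zero hin hG)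

end ModelPleat

open ModelPleat in
/-- **The model pleat chart exists** (registered sub-goal `exists_modelPleatChart` of crux
stmt-SmoothPoincare4-7844, line `shadow-pleats`; non-vacuity of the `k ≥ 1` clauses of
`IsPleatedPosition`): there is a smooth injective immersion `L : ℝ⁴ → ℝ⁵` (an embedded radial
hypersurface germ, the lift of the radial pleat `G u = (60 - 25‖u‖² + 3‖u‖⁴) u` at height `‖u‖²`)
whose shadow `proj5 ∘ L` is immersive exactly off `pleatSpheres` and has a Whitney fold
(`IsFoldPointAt`) at EVERY point of BOTH fold spheres `‖u‖ = 1`, `‖u‖ = 2` of the one chart.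
[folklore] -/
theorem exists_modelPleatChart :
    ∃ L : EuclideanSpace ℝ (Fin 4) → EuclideanSpace ℝ (Fin 5),
      ContDiff ℝ ∞ L ∧ Function.Injective L ∧ (∀ u, Function.Injective (fderiv ℝ L u)) ∧
      (∀ u, u ∉ pleatSpheres → Function.Injective (fderiv ℝ (proj5 ∘ L) u)) ∧
      (∀ u ∈ pleatSpheres, IsFoldPointAt (proj5 ∘ L) u) := by
  refine ⟨L, contDiff_L, injective_L, injective_fderiv_L, fun u hu => ?_, fun u hu => ?_⟩
  · rw [proj5_comp_L, fderiv_G]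
    exact injective_dG hu
  · rw [proj5_comp_L]
    exact isFoldPointAt_G hu

end Summit.SmoothPoincare4.SmoothPoincare4.Theorems.OrigamiFoldExistence.ShadowPleats

end
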